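import Literature.AnabelianGeometry.EtaleTheta.TemperedFrobenioidUnitToyShift
import Literature.AnabelianGeometry.EtaleTheta.Discharge.Sec3Thm37
import Literature.AlgebraicGeometry.Frobenioids.ModelFrobenioidDivision
import Literature.AlgebraicGeometry.Frobenioids.PreFrobenioidDataOfFunctor
import HarnessLib

/-!
# [EtTh] Cor. 3.8 sub-DAG: rows C38-L07 `PreservesFactorisation` (F-2818) and C38-L09 `PreservesFrobeniusTrivial`
# (F-2821) are SCHEMAS over the typed Def. 3.6 interface — universal closures refuted by a UNIT of `Φ`; a second
# witness for row C38-L10 `InducesHullEquivalence` (F-2823)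

S. Mochizuki, *The étale theta function and its Frobenioid-theoretic manifestations*, Publ. RIMS **45** (2009)
[EtTh], Cor. 3.8 "Preservation of Base-field-theoretic Morphisms and Hulls", PDF pp. 80–81, proof PDF pp. 81–82
[cite: MochizukiEtTh2009, Cor 3.8 p.81]; [FrdI] Def. 1.2 pp. 21–23, Thm. 5.2 pp. 100–101
[cite: MochizukiFrdI2008, Thm. 5.2(i) p.100].

PROOF-ONLY companion (0 definitions) of abc-iut-w5-d124's statements-first sub-DAG file `TemperedFrobenioidCor38Sub.lean`
(rows C38-L07 = `Cor38Hyp.PreservesFactorisation` F-2818, C38-L09 = `Cor38Hyp.PreservesFrobeniusTrivial` F-2821,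
C38-L10 = `Cor38Hyp.InducesHullEquivalence` F-2823; all `preparatory`, `parametrised` over
`(T, D, VD, T', D', VD', C₁, C₂, h : Cor38Hyp C₁ C₂)`), abc-iut cell block F, seat abc-iut-f-135. Toy data:
`TemperedFrobenioidUnitToy(Shift).lean` (`UnitToy.frdFull`, `frdNat`, `hypRefl`; `shiftEquiv`, `hypShift`, `hullIso`).
Name: `…UnitNegative` (abc-iut-f-134's `TemperedFrobenioidCor38SubSchemaNegative.lean` decides rows F-2813–F-2816).

WHY THE CLOSURES ARE FALSE (interface findings, not statements about [EtTh]).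
* Rows C38-L07 / L09 quantify over ALL `h : Cor38Hyp C₁ C₂`, i.e. over every equivalence `Ψ : C₁ ⥲ C₂` of the
  underlying categories of two tempered Frobenioids AS TYPED. The typed Def. 3.6 (ii) does not record that `Φ` is
  sharp ("divisorial" is the free predicate `VD.IsDivisorialOn`), so `Φ = ℤ × ℕ` is admissible; then
  `(1, id, n₀, 1) : (A, α) → (A, α + n₀)` (`n₀ = (1,0)` a unit) is an ISOMORPHISM with nonzero zero divisor, and
  conjugation by these isomorphisms is a self-equivalence `Ψ ≅ 𝟭` (`UnitToy.shiftEquiv`) which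
  - sends the degree-`2` Frobenius endomorphism `(2, id, 0, 0)` of `(•, 0)` to an arrow with `Div = n₀ - 2n₀ ≠ 0`,
    NOT an isometry, hence not of Frobenius type (`not_preservesFactorisation`, F-2818: [FrdI] Def. 1.2 (iii)
    "Frobenius type" = LB-invertible base-isomorphism, LB-invertible = co-angular AND `Div = 0` on the nose);
  - sends the Frobenius-trivial object `(•, 0)` ([FrdI] Thm. 5.2 proof, L1's `ModelFrobenioid.isFrobeniusTrivial_zeroObj`)
    to `(•, n₀)`, which has NO base-identity isometric endomorphism of degree `2` (its unit `u` would need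
    `div(u) = n₀ ∉ 0 ⊕ ℤ = div(B)`) (`not_preservesFrobeniusTrivial`, F-2821).
* Row C38-L10 (second conclusion of Cor. 3.8 (ii)) AS TYPED carries no Div-slimness hypothesis and quantifies over two
  structures whose categories are merely equivalent: `F₀^Λ` (constant functions) does not enter
  `TemperedFrobenioid.category`, so `frdFull` (`F₀^Λ = ℤ`) and `frdNat` (`F₀^Λ = ℕ`) have the SAME category (`Ψ = 𝟭`)
  while their hulls are not equivalent: in `frdFull^{bs-fld}` all objects are isomorphic, in `frdNat^{bs-fld}`
  `(•,0) ≇ (•,(0,1))` (an isomorphism would be `(1, id, 0, u)` with constant function `-1 ∉ ℕ`)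
  (`UnitToy.not_inducesHullEquivalence`, for EVERY `h : Cor38Hyp frdFull frdNat`). The universal closure of F-2823 was
  already refuted by abc-iut-f-133 (`Cor38Hyp.not_forall_inducesHullEquivalence`,
  `Discharge/Sec3Cor38HullEquivalenceNegative.lean`, through the `ℝ·Φ₀^cnst` gap of abc-iut-f-015's `TwoPrimes` pair); the
  witness here exhibits the independent `F₀^Λ` gap and is NOT a restatement of that closure theorem.
Hence `Cor38Hyp.not_forall_preservesFactorisation`, `Cor38Hyp.not_forall_preservesFrobeniusTrivial` (universe `0`
closures, binders = the rows' own) — the two rows abc-iut-f-133 / f-134 left undecided ("operations-only rows: a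
countermodel must escape [FrdI] Thm. 3.4": it does so not by moving `deg_Fr` but by moving `Div` by a unit).

INSTANCE FORMS (what print asserts, at the data the cone consumes) are in the tree and CITED, not restated:
C38-L07 ⟸ [FrdI] Thm. 3.4 (ii)(iii) `Cor38Hyp.preservesFactorisation_of_thm34` (w5-d124) — used with the tree theorem
`FrdI.Thm34ii_holds` inside abc-iut-w6-d039's `Cor38Hyp.cor38_i_of_thm34ii` (`Discharge/Sec3Cor38iAssembly.lean`);
C38-L09 ⟸ base squares + Thm. 3.4 (iii) `Cor38Hyp.preservesFrobeniusTrivial_of_inputs` (`Discharge/Sec3Cor38Rows.lean`);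
C38-L10 ⟸ Rmk. 3.6.3 + rows `Cor38Hyp.inducesHullEquivalence_of_rows` (`Discharge/Sec3Cor38Hull.lean`). So the three
rows are admissible AT NAMED INSTANCES ONLY (FACT-LIST class «universal-closure REFUTED / schema; instance forms in
tree»). HONEST FRAMING: bookkeeping about the typing; a refuted closure says nothing about [EtTh] Cor. 3.8, whose
hypotheses (divisorial `Φ`, Div-slim bases) the witnesses violate by design; nothing here bears on [IUTchIII] Cor. 3.12;
no side taken; typed ≠ proved.
-/

noncomputable section

namespace Literature.AnabelianGeometry.EtaleTheta

open CategoryTheory Opposite Literature.AlgebraicGeometry.Frobenioids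

namespace UnitToy

/-- `B = B₀^Λ ×_{(Φ^{ℝ-log})^gp} Φ^gp` is group-like (from `isUnit_BΛ`), the `hBg` of L1's [FrdI] Thm. 5.2 (ii) lemmas.
[cite: MochizukiEtTh2009, Def 3.6 p.77] -/
theorem hBg (F : Submonoid (Multiplicative ℤ)) (hF : Multiplicative.ofAdd (1 : ℤ) ∈ F) :
    Objectwise (fun N _ => IsGroupLike N) (frd F hF).ratFnFunctor :=
  (frd F hF).ratFnFunctor_isGroupLike (realified F).isUnit_BΛ

/-! ## Row C38-L09 `PreservesFrobeniusTrivial` fails for `hypShift` -/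

/-- `(•, 0)` is Frobenius-trivial (L1's [FrdI] Thm. 5.2 proof, `isFrobeniusTrivial_zeroObj`). [cite: MochizukiFrdI2008, Thm. 5.2 p.101] -/
theorem isFrobeniusTrivial_A0 : frdFull.opsData.IsFrobeniusTrivial A0 :=
  (PreFrobenioidData.ofFunctor_isFrobeniusTrivial frdFull.toElem _).2
    (ModelFrobenioid.isFrobeniusTrivial_zeroObj (hBg ⊤ (Submonoid.mem_top _)) pt)

/-- `Div_B(u) = ξ` for `u = (b, ξ) ∈ B` (bookkeeping). [cite: MochizukiEtTh2009, Def 3.6 p.77] -/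
theorem divB_apply (A : (Discrete PUnit.{1})ᵒᵖ) (u : (frdFull.ratFnFunctor.obj A : Type)) :
    divB frdFull.divisorMonoid frdFull.ratFnFunctor frdFull.divBNatTrans A u = u.1.2 := rfl

/-- The fibre-product condition of `B = B₀^Λ ×_{(Φ^{ℝ-log})^gp} Φ^gp`: `div(b) = ι(ξ)` (bookkeeping).
[cite: MochizukiEtTh2009, Def 3.6 p.77] -/
theorem mem_ratFn (A : (Discrete PUnit.{1})ᵒᵖ) (u : (frdFull.ratFnFunctor.obj A : Type)) :
    divHom u.1.1 = frdFull.ΦgpToRlog A u.1.2 := u.2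

/-- First coordinate of `ι(x)` for `x ∈ Φ(A) = ℤ × ℕ` (bookkeeping). [cite: MochizukiEtTh2009, Def 3.6 p.77] -/
theorem fstR_ΦgpToRlog_of (A : (Discrete PUnit.{1})ᵒᵖ) (x : (frdFull.divisorMonoid.obj A : Type)) :
    fstR (frdFull.ΦgpToRlog A (Algebra.GrothendieckGroup.of x)) = x.1.1 := by
  change fstR (gpMap (Submonoid.subtype _) (Algebra.GrothendieckGroup.of x)) = _
  rw [gpMap_of, fstR_of]
  rfl

/-- `Ψ(•, 0) = (•, n₀)` is NOT Frobenius-trivial: a base-identity isometric endomorphism of degree `2` would need a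
rational function `b` with `div(b) = n₀ = (1, 0)`, but `div(B) = 0 ⊕ ℤ`. [cite: MochizukiEtTh2009, Cor 3.8 p.82] -/
theorem not_isFrobeniusTrivial_shift_A0 : ¬ frdFull.opsData.IsFrobeniusTrivial (shiftObj A0) := by
  rintro ⟨ζ, hζ⟩
  obtain ⟨hdeg, -, ⟨-, hiso⟩, -⟩ := hζ 2
  have hrel := ModelFrobenioid.rel (ζ 2)
  change ModelFrobenioid.degFr (ζ 2) = 2 at hdeg
  change ModelFrobenioid.div (ζ 2) = 1 at hiso
  rw [hdeg, hiso, map_one, mul_one, Subsingleton.elim (ModelFrobenioid.baseMap (ζ 2)) (𝟙 pt), pullGp_id,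
    show (((2 : ℕ+) : ℕ)) = 2 from rfl, pow_two, divB_apply] at hrel
  -- `hrel : c * c = c * ξ_u` with `c = cls (Ψ A0) = 0 + n₀`; hence `ξ_u = c`
  have hξ := mul_left_cancel hrel
  -- the rational function `u = (b, ξ_u)` has `div(b) = ι(ξ_u)` in `(Φ^{ℝ-log})^gp`; compare first coordinates
  have hu := mem_ratFn _ (ModelFrobenioid.unit (ζ 2))
  rw [← hξ] at hu
  have h1 := congrArg fstR hu
  have hc : (shiftObj A0).cls = Algebra.GrothendieckGroup.of (n₀Φ (op pt)) := one_mul _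
  rw [hc, fstR_divHom] at h1
  have h3 := h1.trans (fstR_ΦgpToRlog_of (op pt) (n₀Φ (op pt)))
  change (1 : Multiplicative ℤ) = Multiplicative.ofAdd (1 : ℤ) at h3
  exact absurd (congrArg Multiplicative.toAdd h3) (by simp)

/-- **Row C38-L09 / F-2821 fails at `hypShift`**: `Ψ` does not carry Frobenius-trivial objects to Frobenius-trivial
objects. [cite: MochizukiEtTh2009, Cor 3.8 p.82] -/
theorem not_preservesFrobeniusTrivial : ¬ hypShift.PreservesFrobeniusTrivial := fun h9 =>
  not_isFrobeniusTrivial_shift_A0 (h9.1 isFrobeniusTrivial_A0)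

/-! ## Row C38-L07 `PreservesFactorisation` fails for `hypShift` -/

/-- The degree-`2` Frobenius endomorphism `(2, id, 0, 0)` of `(•, 0)` is of Frobenius type. [cite: MochizukiFrdI2008, Thm. 5.2 p.101] -/
theorem isFrobeniusType_frob :
    frdFull.opsData.IsFrobeniusType (ModelFrobenioid.zeroHom 2 (𝟙 pt) : A0 ⟶ A0) :=
  (PreFrobenioidData.ofFunctor_isFrobeniusType frdFull.toElem _).2
    ⟨⟨ModelFrobenioid.isCoAngular (hBg ⊤ (Submonoid.mem_top _)) _, rfl⟩, (inferInstance : IsIso (𝟙 pt))⟩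

/-- `Ψ(2, id, 0, 0) = (1,id,n₀⁻¹,1) ∘ (2,id,0,0) ∘ (1,id,n₀,1)` has zero divisor `n₀ - 2 n₀ = -n₀ ≠ 0`: not an isometry.
[cite: MochizukiEtTh2009, Cor 3.8 p.81] -/
theorem not_isIsometry_shift_frob :
    ¬ frdFull.opsData.IsIsometry (shiftEquiv.functor.map (ModelFrobenioid.zeroHom 2 (𝟙 pt) : A0 ⟶ A0)) := by
  change (frdFull.divisorMonoid.map (𝟙 pt).op).hom
      ((frdFull.divisorMonoid.map (𝟙 pt).op).hom (n₀Φ (op pt)) * 1 ^ (((1 : ℕ+)) : ℕ)) *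
      n₀invΦ (op pt) ^ ((((1 : ℕ+) * 2 : ℕ+)) : ℕ) ≠ 1
  rw [divisorMonoid_map_id_apply, divisorMonoid_map_id_apply, one_pow, mul_one,
    show ((((1 : ℕ+) * 2 : ℕ+)) : ℕ) = 2 from rfl, pow_two, ← mul_assoc, n₀Φ_mul_n₀invΦ, one_mul]
  exact n₀invΦ_ne_one _

/-- **Row C38-L07 / F-2818 fails at `hypShift`**: `Ψ` does not carry morphisms of Frobenius type to morphisms of
Frobenius type. [cite: MochizukiEtTh2009, Cor 3.8 p.81] -/
theorem not_preservesFactorisation : ¬ hypShift.PreservesFactorisation := fun h7 =>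
  not_isIsometry_shift_frob (h7.2.1.1 _ isFrobeniusType_frob).1.2


/-! ## Row C38-L10 `InducesHullEquivalence` fails for `hypRefl`: one category, two non-equivalent hulls -/

/-- `Φ^{bs-fld} = 0 × ℕ` is sharp: `a + b = 0 ⟹ b = 0`. [cite: MochizukiEtTh2009, Def 3.6 p.77] -/
theorem bs_eq_one_of_mul_eq_one (F : Submonoid (Multiplicative ℤ)) (hF : Multiplicative.ofAdd (1 : ℤ) ∈ F)
    (A : (Discrete PUnit.{1})ᵒᵖ) (a b : ((frd F hF).bsFldMonoid.obj A : Type)) (h : a * b = 1) : b = 1 := by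
  have hb1 : b.1.1 = 1 := (mem_bs_iff F hF A b.1).1 b.2
  have h2 := congrArg (fun z : ((frd F hF).bsFldMonoid.obj A : Type) => Multiplicative.toAdd z.1.2) h
  change Multiplicative.toAdd (a.1.2 * b.1.2) = Multiplicative.toAdd (1 : Multiplicative ℕ) at h2
  rw [toAdd_mul, toAdd_one] at h2
  have hb2 : Multiplicative.toAdd b.1.2 = 0 := Nat.eq_zero_of_add_eq_zero_left h2
  apply Subtype.ext
  refine Prod.ext hb1 ?_
  change b.1.2 = 1
  rw [← ofAdd_toAdd b.1.2, hb2]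
  rfl

/-- Second coordinate of `ι(ξ)` for `ξ ∈ Φ^{bs-fld}` (bookkeeping). [cite: MochizukiEtTh2009, Def 3.6 p.77] -/
theorem sndR_bsFldGpToRlog_of (F : Submonoid (Multiplicative ℤ)) (hF : Multiplicative.ofAdd (1 : ℤ) ∈ F)
    (x : ↥((frd F hF).bsFld.carrier (op pt))) :
    sndR ((frd F hF).bsFldGpToRlog (op pt) (Algebra.GrothendieckGroup.of x)) =
      Multiplicative.ofAdd ((Multiplicative.toAdd x.1.2 : ℕ) : ℤ) := by
  change sndR (gpMap (Submonoid.subtype _) (Algebra.GrothendieckGroup.of x)) = _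
  rw [gpMap_of, sndR_of]
  rfl

/-- In the hull of `frdNat` (`F₀^Λ = ℕ`), `(•, 0) ≇ (•, x₁)`: an isomorphism is `(1, id, 0, u)` with `Div(u) = -x₁`, i.e.
a constant function `b = -1 ∉ ℕ`. [cite: MochizukiEtTh2009, Def 3.6 p.78] -/
theorem hull_no_iso (e : B0 ≅ B1) : False := by
  have hd : ModelFrobenioid.degFr e.hom = 1 := ModelFrobenioid.degFr_eq_one_of_isIso e.hom
  have hd' : ModelFrobenioid.degFr e.inv = 1 := ModelFrobenioid.degFr_eq_one_of_isIso e.inv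
  have hcomp := congrArg ModelFrobenioid.div e.hom_inv_id
  change (frdNat.bsFldMonoid.map (ModelFrobenioid.baseMap e.hom).op).hom (ModelFrobenioid.div e.inv) *
      ModelFrobenioid.div e.hom ^ (ModelFrobenioid.degFr e.inv : ℕ) = 1 at hcomp
  rw [hd', PNat.one_coe, pow_one] at hcomp
  have hdiv : ModelFrobenioid.div e.hom = 1 := bs_eq_one_of_mul_eq_one _ _ _ _ _ hcomp
  have hrel := ModelFrobenioid.rel e.hom
  rw [hd, hdiv, PNat.one_coe, pow_one, map_one, mul_one, Subsingleton.elim (ModelFrobenioid.baseMap e.hom) (𝟙 pt),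
    pullGp_id, divF_apply] at hrel
  -- `hrel : 0 = x₁ + Div_F(u)`, so `Div_F(u) = -x₁`
  have hξ : (ModelFrobenioid.unit e.hom).1.2 = (Algebra.GrothendieckGroup.of n₁bs)⁻¹ :=
    eq_inv_of_mul_eq_one_right hrel.symm
  obtain ⟨hF, hdv⟩ := (ModelFrobenioid.unit e.hom).2
  have hF' : (ModelFrobenioid.unit e.hom).1.1 ∈ Submonoid.powers (Multiplicative.ofAdd (1 : ℤ)) := hF
  have hb : sndR (divHom (ModelFrobenioid.unit e.hom).1.1) =
      sndR (frdNat.bsFldGpToRlog (op pt) (Algebra.GrothendieckGroup.of n₁bs)⁻¹) := by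
    rw [← hξ]; exact congrArg sndR hdv
  have hR : sndR (frdNat.bsFldGpToRlog (op pt) (Algebra.GrothendieckGroup.of n₁bs)⁻¹) =
      Multiplicative.ofAdd (-1 : ℤ) := by
    have h1 : frdNat.bsFldGpToRlog (op pt) (Algebra.GrothendieckGroup.of n₁bs)⁻¹ =
        (frdNat.bsFldGpToRlog (op pt) (Algebra.GrothendieckGroup.of n₁bs))⁻¹ := map_inv _ _
    have h2 := sndR_bsFldGpToRlog_of natPowers one_mem_natPowers n₁bs
    have h3 : sndR ((frdNat.bsFldGpToRlog (op pt) (Algebra.GrothendieckGroup.of n₁bs))⁻¹) =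
        (sndR (frdNat.bsFldGpToRlog (op pt) (Algebra.GrothendieckGroup.of n₁bs)))⁻¹ := map_inv sndR _
    exact (congrArg sndR h1).trans (h3.trans (by rw [h2]; rfl))
  have hval : (ModelFrobenioid.unit e.hom).1.1 = Multiplicative.ofAdd (-1 : ℤ) :=
    (sndR_divHom _).symm.trans (hb.trans hR)
  obtain ⟨k, hk⟩ := (Submonoid.mem_powers_iff _ _).1 hF'
  have hk2 : (Multiplicative.ofAdd (1 : ℤ)) ^ k = Multiplicative.ofAdd (-1 : ℤ) := hk.trans hval
  have hk' := congrArg Multiplicative.toAdd hk2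
  rw [toAdd_pow, toAdd_ofAdd, toAdd_ofAdd, nsmul_eq_mul, mul_one] at hk'
  omega

/-- In the hull of `frdFull` (`F₀^Λ = ℤ`) ALL objects are isomorphic. [cite: MochizukiEtTh2009, Def 3.6 p.78] -/
theorem hullFull_allIso (X Y : frdFull.hullCategory) : Nonempty (X ≅ Y) := by
  obtain ⟨⟨⟨⟩⟩, c⟩ := X
  obtain ⟨⟨⟨⟩⟩, c'⟩ := Y
  exact ⟨hullIso c c'⟩

/-- **Row C38-L10 / F-2823 fails for EVERY `h : Cor38Hyp frdFull frdNat`** (in particular `hypRefl`): the hulls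
`frdFull^{bs-fld}` (connected by isomorphisms) and `frdNat^{bs-fld}` (with `(•,0) ≇ (•,x₁)`) are not equivalent
categories at all. [cite: MochizukiEtTh2009, Cor 3.8 p.82] -/
theorem not_inducesHullEquivalence (h : Cor38Hyp frdFull frdNat) : ¬ h.InducesHullEquivalence := by
  rintro ⟨Ψbs, -⟩
  obtain ⟨e⟩ := hullFull_allIso (Ψbs.inverse.obj B0) (Ψbs.inverse.obj B1)
  exact hull_no_iso ((Ψbs.counitIso.app B0).symm ≪≫ Ψbs.functor.mapIso e ≪≫ Ψbs.counitIso.app B1)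
end UnitToy

/-! ## The universal closures of the three rows are false -/

namespace Cor38Hyp

/-- **F-2818 (`PreservesFactorisation`, row C38-L07) — universal closure REFUTED over the typed interface**: at the
tempered Frobenioid `UnitToy.frdFull` (Φ = ℤ × ℕ has a unit) the shift self-equivalence `Ψ ≅ 𝟭` carries the degree-2
Frobenius endomorphism `(2, id, 0, 0)` of `(•, 0)` to an arrow with zero divisor `-n₀ ≠ 0`, not of Frobenius type.
The row holds at the data the cone consumes (`preservesFactorisation_of_thm34`, [FrdI] Thm. 3.4 (ii)(iii)); print's
Φ is divisorial, hence sharp. [cite: MochizukiEtTh2009, Cor 3.8 p.81] -/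
theorem not_forall_preservesFactorisation :
    ¬ ∀ (D₀ : Type) (_ : Category.{0} D₀) (V : FrdIMonoidStub.{0}) (T : RealifiedDivisorMonoids (D₀ := D₀) V)
        (D : Type) (_ : Category.{0} D) (VD : FrdICatStub.{0, 0, 0} D)
        (D₀' : Type) (_ : Category.{0} D₀') (T' : RealifiedDivisorMonoids (D₀ := D₀') V)
        (D' : Type) (_ : Category.{0} D') (VD' : FrdICatStub.{0, 0, 0} D')
        (C₁ : TemperedFrobenioid T D VD) (C₂ : TemperedFrobenioid T' D' VD') (h : Cor38Hyp C₁ C₂),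
        h.PreservesFactorisation := fun H =>
  UnitToy.not_preservesFactorisation (H _ _ _ _ _ _ _ _ _ _ _ _ _ _ _ UnitToy.hypShift)

/-- **F-2821 (`PreservesFrobeniusTrivial`, row C38-L09) — universal closure REFUTED over the typed interface**: the
same `Ψ ≅ 𝟭` carries the Frobenius-trivial object `(•, 0)` to `(•, n₀)`, which admits no base-identity isometric
endomorphism of degree `2` (`div(B) = 0 ⊕ ℤ ∌ n₀`). The row holds at the data the cone consumes
(`preservesFrobeniusTrivial_of_inputs`, [FrdI] Thm. 3.4 (iii) + Cor. 4.11 (ii)). [cite: MochizukiEtTh2009, Cor 3.8 p.82] -/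
theorem not_forall_preservesFrobeniusTrivial :
    ¬ ∀ (D₀ : Type) (_ : Category.{0} D₀) (V : FrdIMonoidStub.{0}) (T : RealifiedDivisorMonoids (D₀ := D₀) V)
        (D : Type) (_ : Category.{0} D) (VD : FrdICatStub.{0, 0, 0} D)
        (D₀' : Type) (_ : Category.{0} D₀') (T' : RealifiedDivisorMonoids (D₀ := D₀') V)
        (D' : Type) (_ : Category.{0} D') (VD' : FrdICatStub.{0, 0, 0} D')
        (C₁ : TemperedFrobenioid T D VD) (C₂ : TemperedFrobenioid T' D' VD') (h : Cor38Hyp C₁ C₂),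
        h.PreservesFrobeniusTrivial := fun H =>
  UnitToy.not_preservesFrobeniusTrivial (H _ _ _ _ _ _ _ _ _ _ _ _ _ _ _ UnitToy.hypShift)

end Cor38Hyp

end Literature.AnabelianGeometry.EtaleTheta

end
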